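import Summits.Langlands.Langlands.Theses.ParityBlindBianchi
import Literature.NumberTheory.Automorphic.BaseChangeGLnProofs

/-!
# Disproof of `QuadraticDescentGL2` (crux stmt-Langlands-16811, route ParityBlindBianchi) — findings

Standing disprover work file (cdisprove, cycle 1, 2026-08-17). Prose only in docstrings/comments.

**Verdict so far: NO KILL, and no kill is expected.** The crux is, verbatim, the `n = 2`,
`[E:F] = 2` instance of the tree's named fact
`Literature.NumberTheory.Automorphic.cuspidal_descent_cyclic` (Arthur–Clozel Ch. 3 Thm 4.2 (d);
Langlands 1980 for `GL(2)`), stated over a Satake layer whose two Flath facts are THEOREMS of the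
tree (`AutomorphicRepData.hasSatakeParamAt_cofinite_holds`, `…_unique_holds`,
`AutomorphicRepsGLSatakeFlathProofs`): every `π : CuspidalAutomorphicRepData` has a unique Satake
parameter at all but finitely many places. Hence neither side of the implication has a junk or
vacuous sector: `IsWeakBaseChangeLiftAE π.1 P.1` is never satisfied "for lack of Satake data", and
`IsGaloisStableSatakeAE F P.1` is a genuine constraint.

## Index of findings

* §a LOAD-BEARING ANALYSIS
  * a1 `[IsGalois F E]` is NOT load-bearing: redundant with `Module.finrank F E = 2` in
    characteristic `0` (`isGalois_of_finrank_eq_two`, Mathlib `IsQuadraticExtension.isGalois`);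
    `quadraticDescentGL2WithoutIsGalois_iff` (kernel-checked). Provers may discharge the instance,
    planners may drop the binder.
  * a2 `IsGaloisStableSatakeAE F P.1` IS load-bearing and SHARP: it is implied by the conclusion
    (`galoisStable_of_weakLift`, one line over the tree theorem
    `IsWeakBaseChangeLiftAE.isGaloisStableSatakeAE'`, A–C Ch. 3 Prop. 4.4 (i)). So the crux says
    exactly "on cuspidal data, Galois-stable = image of weak quadratic base change", an `iff`
    (`quadraticDescentGL2_iff_image`). Dropping the hypothesis (`QuadraticDescentGL2WithoutStability`)
    is refuted by ANY single cuspidal datum with non-stable Satake data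
    (`withoutStability_false_of`, kernel-checked modulo that existence, which the tree cannot
    construct: no inhabitant of `CuspidalAutomorphicRepData` exists in the tree).
  * a3 cuspidality of `P` is load-bearing (informal; the tree types `P` cuspidal): the isobaric
    `P = χ∘N ⊞ μ∘N` is automorphic with Galois-stable Satake data but is a weak lift only of
    `χηⁱ ⊞ μηʲ`, none cuspidal (a cuspidal `π` with non-cuspidal quadratic base change is dihedral
    `AI(θ)`, `BC(AI θ) = θ ⊞ θ^σ` with `θ ≠ θ^σ`, whereas `χ∘N` is `σ`-fixed).
  * a4 `finrank F E = 2` (prime-degree cyclicity) is load-bearing for GENERALISATION only: for a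
    Galois NON-cyclic `E/F` the analogue fails already at `n = 1` — a `Gal(E/F)`-invariant idele
    class character of `E` need not factor through `N_{E/F}` since
    `ker N / I_G C_E = Ĥ⁻¹(G, C_E) ≅ Ĥ⁻³(G, ℤ) = H₂(G, ℤ) = ℤ/2` for `G = (ℤ/2)²` (Tate's theorem on
    the cohomology of idele classes); prime degree is what A–C III.4.2 (d) proves and what is typed.
  * a5 `hF`, `hE` are `Prop`s (proof-irrelevant); `F E : Type` is forced by the datum; no
    `n = 0/1`, `F = E` or empty-family sector (finrank 2, n = 2 fixed).
  * a6 GENERALITY NOT CONSUMED (planner information, not a defect): the route's only use site is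
    `anchor_descent` (`Theorems/ParityBlindBianchiIcosahedralDescentLevelAnchor.lean:71`,
    `hdesc 2 ℚ K₁ …`): descent to `F = ℚ` from ONE imaginary quadratic anchor field `K₁ = ℚ(√-D₁)`
    of a `P` whose Satake data are Frobenius data of `ρ|_{K₁}`. `QuadraticDescentGL2` restricted to
    `F = ℚ` would serve `closes` equally (still Langlands 1980, still XL).
* §b TIGHTNESS: = a2 (the hypothesis cannot be weakened; the conclusion cannot be strengthened to
  "unique `π`": `π ⊗ η_{E/F}` lifts to the same `P`, tree `IsWeakBaseChangeLiftAE.of_twist_quadraticSign`,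
  and as DATA `(W' ⊕ V, W')`, `(V, ⊥)` are distinct models with identical Satake parameters).
* §c natural strengthenings refuted in small models: none expressible without an inhabitant of
  `CuspidalAutomorphicRepData` (see §e).
* §d Targets: none this cycle (`payload.targets = []`, no line picked).
* §e WHY IT RESISTS / drift audit (the planner's "why it might fail" list, item by item):
  1. free `|det|^s` twist in `CuspidalAutomorphicRepData` (non-unitary central characters
     allowed): harmless — `|ω_P| = ‖·‖^t` with `t` real (compactness of `C_E¹`), `P ⊗ |det|^{-t/2}`
     is unitary cuspidal and still Galois-stable (`q_w` is constant on the places over `v`),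
     descend by A–C, untwist over `F` using `q_w = q_v^{f(w|v)}`;
  2. a.e. Satake shadow of `P ≅ P^σ`: equivalent for cuspidal `P` by Jacquet–Shalika strong
     multiplicity one (unramified `P_w ∘ σ_w` has the Satake parameter of `P_{σw}`);
  3. weak lift a.e. with `α ↦ α.map (· ^ f(w|v))`: the unramified base-change relation, exact;
     ramified `w` are finitely many and absorbed by `∀ᶠ`;
  4. Hecke normalisation `(√q_v)^{i(n-i)} e_i(α)` and the `rightTranslation` convention: any
     place-uniform reparametrisation `α ↦ q_v^c α^{±1}` commutes with `α ↦ α^f` (`q_w = q_v^f`) and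
     with Galois-stability, so even a convention slip could not separate hypothesis from conclusion;
  5. `principalCongruenceLevel` has trivial archimedean component and `heckeOperator` is
     representative-independent on `K(𝔫)`-fixed vectors (`heckeOperator_apply_eq_sum`): no junk
     eigen-equations, and Flath uniqueness is a theorem.
  Every `¬`-shape (of the crux, of a weakening, of a strengthening) needs (i) an inhabitant of
  `CuspidalAutomorphicRepData 2 E hE` — absent from the tree (no cusp form on any `GL₂(𝔸_E)` has
  been constructed) — and (ii) a census of ALL cuspidal `π` over `F` with their Satake data, which
  is the theorem itself. No `H → ¬ QuadraticDescentGL2` with a believable `H` exists: the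
  statement is true in print. Literature on Galois-invariant-but-not-base-change phenomena
  (Lapid–Rogawski 1998, doi:10.1515/form.10.2.175; Rajan 2002, doi:10.4310/mrl.2002.v9.n4.a9;
  Clozel–Rajan 2020, doi:10.1515/crelle-2020-0023; located via crossref — the hub's local
  searchd was down this session) concerns NON-cyclic solvable `E/F` and the fibres of lifting,
  never prime degree: it supports a4, not a kill.
-/

set_option linter.dupNamespace false

namespace Summit.Langlands.Langlands.Cruxes.QuadraticDescentGL2.Disproof

open Literature.NumberTheory.Automorphic
open Summit.Langlands.Langlands.Theses.ParityBlindBianchi (QuadraticDescentGL2)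

/-! ## §a1 — the instance binder `[IsGalois F E]` is redundant -/

/-- A quadratic extension of number fields is Galois (degree `2`, characteristic `0`:
separable because `F` is perfect, normal because a quadratic extension is; Mathlib
`IsQuadraticExtension.isGalois`). [folklore] -/
theorem isGalois_of_finrank_eq_two (F E : Type) [Field F] [NumberField F] [Field E] [NumberField E]
    [Algebra F E] (h2 : Module.finrank F E = 2) : IsGalois F E := by
  haveI : Algebra.IsQuadraticExtension F E := ⟨h2⟩
  haveI : FiniteDimensional F E := Module.finite_of_finrank_pos (by omega)
  infer_instance

/-- The crux with the instance binder `[IsGalois F E]` DROPPED (everything else verbatim). -/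
def QuadraticDescentGL2WithoutIsGalois : Prop :=
  ∀ (F E : Type) [Field F] [NumberField F] [Field E] [NumberField E] [Algebra F E],
    Module.finrank F E = 2 →
      ∀ (hF : isCompact_glFiniteIntegralLevel 2 F) (hE : isCompact_glFiniteIntegralLevel 2 E)
        (P : CuspidalAutomorphicRepData 2 E hE), IsGaloisStableSatakeAE F P.1 →
          ∃ π : CuspidalAutomorphicRepData 2 F hF, IsWeakBaseChangeLiftAE π.1 P.1

/-- **a1.** `[IsGalois F E]` is not load-bearing: the crux is equivalent to the same statement
without it (`isGalois_of_finrank_eq_two`). [folklore] -/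
theorem quadraticDescentGL2WithoutIsGalois_iff :
    QuadraticDescentGL2WithoutIsGalois ↔ QuadraticDescentGL2 := by
  constructor
  · intro h F E _ _ _ _ _ _ h2 hF hE P hP
    exact h F E h2 hF hE P hP
  · intro h F E _ _ _ _ _ h2 hF hE P hP
    haveI := isGalois_of_finrank_eq_two F E h2
    exact h F E h2 hF hE P hP

/-! ## §a2 / §b — Galois-stability is necessary: the crux is an image statement -/

/-- **a2 (necessity, = tightness).** The conclusion of the crux forces its hypothesis: a cuspidal
datum on `GL₂(𝔸_E)` that is a weak base-change lift of ANY automorphic datum on `GL₂(𝔸_F)` has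
Galois-stable Satake data (tree theorem `IsWeakBaseChangeLiftAE.isGaloisStableSatakeAE'`,
Arthur–Clozel Ch. 3 Prop. 4.4 (i), fed by the Flath theorems). So the hypothesis
`IsGaloisStableSatakeAE F P.1` cannot be weakened. [cite: ArthurClozelAMS120, Ch. 3, Prop. 4.4 (i)] -/
theorem galoisStable_of_weakLift (F E : Type) [Field F] [NumberField F] [Field E] [NumberField E]
    [Algebra F E] [IsGalois F E] {hF : isCompact_glFiniteIntegralLevel 2 F}
    {hE : isCompact_glFiniteIntegralLevel 2 E} (π : CuspidalAutomorphicRepData 2 F hF)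
    (P : CuspidalAutomorphicRepData 2 E hE) (h : IsWeakBaseChangeLiftAE π.1 P.1) :
    IsGaloisStableSatakeAE F P.1 :=
  h.isGaloisStableSatakeAE'

/-- **a2′.** Consequently the crux is EQUIVALENT to the `iff`-form "for cuspidal `P` on
`GL₂(𝔸_E)`, `E/F` quadratic: Galois-stable Satake data ⟺ weak base change of a cuspidal `π`".
The `⟸` half is the tree theorem; the crux is exactly the `⟹` half. [folklore] -/
theorem quadraticDescentGL2_iff_image :
    QuadraticDescentGL2 ↔
      ∀ (F E : Type) [Field F] [NumberField F] [Field E] [NumberField E] [Algebra F E]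
        [IsGalois F E], Module.finrank F E = 2 →
          ∀ (hF : isCompact_glFiniteIntegralLevel 2 F) (hE : isCompact_glFiniteIntegralLevel 2 E)
            (P : CuspidalAutomorphicRepData 2 E hE),
              IsGaloisStableSatakeAE F P.1 ↔
                ∃ π : CuspidalAutomorphicRepData 2 F hF, IsWeakBaseChangeLiftAE π.1 P.1 := by
  constructor
  · intro h F E _ _ _ _ _ _ h2 hF hE P
    exact ⟨h F E h2 hF hE P, fun ⟨π, hπ⟩ => galoisStable_of_weakLift F E π P hπ⟩
  · intro h F E _ _ _ _ _ _ h2 hF hE P hP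
    exact (h F E h2 hF hE P).1 hP

/-- The crux with the Galois-stability hypothesis DROPPED (everything else verbatim): "every
cuspidal `P` on `GL₂(𝔸_E)` is a weak quadratic base change". -/
def QuadraticDescentGL2WithoutStability : Prop :=
  ∀ (F E : Type) [Field F] [NumberField F] [Field E] [NumberField E] [Algebra F E] [IsGalois F E],
    Module.finrank F E = 2 →
      ∀ (hF : isCompact_glFiniteIntegralLevel 2 F) (hE : isCompact_glFiniteIntegralLevel 2 E)
        (P : CuspidalAutomorphicRepData 2 E hE),
          ∃ π : CuspidalAutomorphicRepData 2 F hF, IsWeakBaseChangeLiftAE π.1 P.1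

/-- `H_a2`: there is ONE cuspidal datum on `GL₂` over some quadratic extension of number fields
whose Satake data are NOT Galois-stable (in print: any cuspidal `P₀` twisted by a Hecke character
`μ` of `E` with `μ_w ≠ μ_{σw}` at infinitely many split `w`; or `BC(π) ⊗ μ`). Not constructible in
the tree: no inhabitant of `CuspidalAutomorphicRepData n K hcpt` exists for any `K`.
[topic NumberTheory/Automorphic] -/
def ExistsNonStableCuspidalDatum : Prop :=
  ∃ (F E : Type) (_ : Field F) (_ : NumberField F) (_ : Field E) (_ : NumberField E)
    (_ : Algebra F E) (_ : IsGalois F E) (_ : Module.finrank F E = 2)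
    (_ : isCompact_glFiniteIntegralLevel 2 F) (hE : isCompact_glFiniteIntegralLevel 2 E)
    (P : CuspidalAutomorphicRepData 2 E hE), ¬ IsGaloisStableSatakeAE F P.1

/-- **a2″ (`_false_without_` Galois-stability, modulo one inhabitant).** Any proof of the crux
must use `IsGaloisStableSatakeAE F P.1`: the statement without it contradicts the existence of a
single non-stable cuspidal datum (`galoisStable_of_weakLift`). [folklore] -/
theorem withoutStability_false_of (H : ExistsNonStableCuspidalDatum) :
    ¬ QuadraticDescentGL2WithoutStability := by
  intro h
  obtain ⟨F, E, _, _, _, _, _, _, h2, hF, hE, P, hP⟩ := H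
  obtain ⟨π, hπ⟩ := h F E h2 hF hE P
  exact hP (galoisStable_of_weakLift F E π P hπ)

/-! ## §e — near-misses

None with mathematical content: see the module docstring. The only `¬`-statement about the crux
itself that type-checks is the tautological `¬ QuadraticDescentGL2 → ¬ QuadraticDescentGL2`; no
hypothesis `H` believed true makes `H → ¬ QuadraticDescentGL2` plausible (theorem in print). -/

end Summit.Langlands.Langlands.Cruxes.QuadraticDescentGL2.Disproof
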